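import Literature.AlgebraicGeometry.HodgeTheory.VHSDataHodgeClassesAlongSubvariations
import HarnessLib

/-!
# Hodge-genericity is an ISOGENY INVARIANT: for morphisms `φ : D → D'`, `ψ : D' → D` of VHS data with `ψ ∘ φ = N ≠ 0` on the lattices, `φ` and `ψ^∨`
# are injective, so `φ^{⊗a} ⊗ (ψ^∨)^{⊗b} : T^{a,b}D → T^{a,b}D'` is injective and the exceptional Hodge loci of all `T^{a,b}D` lie in those of
# `T^{a,b}D'`; for an isogeny (`ψ ∘ φ = N`, `φ ∘ ψ = N'`) the exceptional loci and the Hodge-generic loci COINCIDE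

Topic `Literature/AlgebraicGeometry/HodgeTheory` (namespace `Literature.AlgebraicGeometry.Motives.VHSData`), lane `lit-hodgefound` (seat `p08`, row g61-#18);
sequel of `VHSDataHodgeClassesAlongSubvariations` (`exceptionalHodgeLocus_subset_of_forall_injective`: lattice-injective morphisms, via STRICTNESS) and
`VHSDataHodgeGenericPointsRetracts` (the case `N = 1`), over the tree's tensor constructions of morphisms (`Motives/FamiliesVHSTensorMorphism`: `Hom.tensor`,
`Hom.dualMap`; `Motives/FamiliesVHSTensorPower`: `Hom.tensorPow`) and Mathlib's `TensorProduct.map_injective_of_flat_flat` (lattices are free, hence flat).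
THEOREMS ONLY — no definition, no named fact, no instance (D-0026 net debt `0`).

PRINTED SOURCES.  M. Green, P. Griffiths, M. Kerr, *Mumford–Tate Groups and Domains* (2012), Ch. I (I.B) and Ch. III (III.2): the Mumford–Tate group, hence
Hodge-genericity, depends only on the RATIONAL Hodge structure ∕ variation (isogenous lattices give the same notion); P. Deligne, LNM 900 (1982), I §3, 3.1
(the `T^{a,b}` and their functoriality); C. Voisin, *Hodge Theory II*, §5.3.1, §5.3.3; P. Deligne, *Théorie de Hodge II*, Thm. 2.3.5 (strictness), 1.1.12;
N. Bourbaki, *Algebra I*, Ch. II §4 (transpose, tensor products of injective maps of free modules); W. Schmid (1973), §2 (`H_ℚ = H_ℤ ⊗ ℚ`).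

CONTENT (`φ : Hom D D'`, `ψ : Hom D' D`, `N : ℤ`, `N ≠ 0`, `hψφ : ∀ s u, ψ_s (φ_s u) = N • u`).
* §1 INTEGER MULTIPLES: `eq_zero_of_zsmul_eq_zero` (lattices are torsion-free), **`isHodgeAt_zsmul_iff`**, **`isHodgeAlong_zsmul_iff`** (`N • u` is of type
  `(p,p)` ∕ generic iff `u` is).
* §2 QUASI-RETRACTS `ψ ∘ φ = N`: `Hom.injective_app_of_quasiRetract` (`φ_s` injective), `Hom.injective_dualMap_app_of_quasiRetract` (`(ψ^∨)_s` injective),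
  **`isHodgeAlong_app_iff_of_quasiRetract`** (elementary, no strictness: `ψ (φ u) = N u`), **`exceptionalHodgeLocus_subset_of_quasiRetract`**,
  `exceptionalHodgeLocus_eq_of_isogeny`.
* §3 TENSOR CONSTRUCTIONS: `Hom.injective_tensor_app`, `Hom.injective_tensorPow_app` (tensor products ∕ powers of lattice-injective morphisms are
  lattice-injective: flatness of free `ℤ`-modules), **`injective_tensorSpaceMap_app_of_quasiRetract`** (`φ^{⊗a} ⊗ (ψ^∨)^{⊗b}` is injective on
  `T^{a,b}`), **`exceptionalHodgeLocus_tensorSpace_subset_of_quasiRetract`** (strictness, via the prequel), `exceptionalHodgeLocus_tensorSpace_eq_of_isogeny`.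
* §4 **`hodgeGenericLocus_subset_of_quasiRetract`** (`hodgeGenericLocus D' ⊆ hodgeGenericLocus D`), **`hodgeGenericLocus_eq_of_isogeny`** (HODGE-GENERICITY IS AN
  ISOGENY INVARIANT).

HONEST SCOPE.  Integral morphisms on the hypothesis structure `VHSData`; «isogeny» means the pair of lattice identities `ψ ∘ φ = N`, `φ ∘ ψ = N'` with
`N, N' ≠ 0` (no finiteness of cokernels is used beyond what these identities give); no holomorphy.

## References

* [GreenGriffithsKerr2012] M. Green, P. Griffiths, M. Kerr, *Mumford–Tate Groups and Domains*, Ann. of Math. Studies 183 (2012), Ch. I (I.B), Ch. III (III.2).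
* [Deligne1982HodgeCycles] P. Deligne, *Hodge cycles on abelian varieties*, LNM 900 (1982), I §3, 3.1.
* [VoisinHodgeII2003] C. Voisin, *Hodge Theory and Complex Algebraic Geometry II*, CUP (2003), §5.3.1, §5.3.3.
* [DeligneHodgeII1971] P. Deligne, *Théorie de Hodge II*, Publ. Math. IHÉS 40 (1971), 1.1.12, Thm. 2.3.5.
* [BourbakiAlgebraI1989] N. Bourbaki, *Algebra I*, Springer (1989), Ch. II §4, §5.
* [Schmid1973] W. Schmid, *Variation of Hodge structure: the singularities of the period mapping*, Invent. Math. 22 (1973), §2.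
-/

noncomputable section

open _root_.Topology _root_.Filter Set
open scoped TensorProduct

namespace Literature.AlgebraicGeometry

open Motives Motives.HodgeStructure HodgeTheory Topology

namespace Motives.VHSData

variable {S : Type} [TopologicalSpace S] {k : ℤ}

/-! ## §1 Integer multiples of classes of type `(p,p)` -/

section ZSMul

variable (D : VHSData S k) {p : ℤ} {s : S} {N : ℤ}

/-- Lattices are torsion-free: `N • u = 0`, `N ≠ 0` ⟹ `u = 0` (through `toRat`, which is injective). [cite: Schmid1973, §2] -/
theorem eq_zero_of_zsmul_eq_zero (hN : N ≠ 0) {u : D.VZ.fiber s} (h : N • u = 0) : u = 0 := by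
  have h' : (N : ℚ) • D.toRat s u = 0 := by rw [Int.cast_smul_eq_zsmul, ← map_zsmul, h, map_zero]
  exact D.toRat_injective_holds s (by rw [map_zero]; exact (smul_eq_zero.1 h').resolve_left (Int.cast_ne_zero.2 hN))

/-- **`N • u` is of type `(p,p)` at `s` iff `u` is** (`N ≠ 0`; Hodge classes form a `ℚ`-subspace). [cite: VoisinHodgeII2003, §5.3.1] -/
theorem isHodgeAt_zsmul_iff (hN : N ≠ 0) (u : D.VZ.fiber s) : D.IsHodgeAt s p (N • u) ↔ D.IsHodgeAt s p u := by
  change D.toRat s (N • u) ∈ (D.hodge s).hodgeClasses p ↔ D.toRat s u ∈ (D.hodge s).hodgeClasses p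
  rw [map_zsmul, ← Int.cast_smul_eq_zsmul ℚ, Submodule.smul_mem_iff _ (Int.cast_ne_zero.2 hN)]

/-- **`N • u` is generic along `W` iff `u` is** (`N ≠ 0`). [cite: VoisinHodgeII2003, §5.3.1] [cite: CattaniDeligneKaplan1995, §1 (p. 483)] -/
theorem isHodgeAlong_zsmul_iff (hN : N ≠ 0) (u : D.VZ.fiber s) (W : Set S) : D.IsHodgeAlong p (N • u) W ↔ D.IsHodgeAlong p u W := by
  refine ⟨fun h t γ hγ => ?_, fun h => h.zsmul N⟩
  have h' := h γ hγ
  rw [map_zsmul] at h'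
  exact (D.isHodgeAt_zsmul_iff hN _).1 h'

end ZSMul

/-! ## §2 Quasi-retracts `ψ ∘ φ = N` -/

section QuasiRetract

variable {D D' : VHSData S k} {φ : Hom D D'} {ψ : Hom D' D} {N : ℤ}

/-- `ψ ∘ φ = N ≠ 0` ⟹ `φ_s` is injective. [cite: BourbakiAlgebraI1989, Ch. II §1] -/
theorem Hom.injective_app_of_quasiRetract (hN : N ≠ 0) (hψφ : ∀ (s : S) (u : D.VZ.fiber s), ψ.app s (φ.app s u) = N • u) (s : S) :
    Function.Injective (φ.app s) := by
  rw [injective_iff_map_eq_zero]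
  intro u hu
  exact D.eq_zero_of_zsmul_eq_zero hN (by rw [← hψφ s u, hu, map_zero])

/-- `ψ ∘ φ = N ≠ 0` ⟹ `(ψ^∨)_s : (V_ℤ,s)^∨ → (V'_ℤ,s)^∨` is injective (`χ ∘ ψ_s = 0` ⟹ `N χ = χ ∘ ψ_s ∘ φ_s = 0` ⟹ `χ = 0`).
[cite: BourbakiAlgebraI1989, Ch. II §2 no. 5] -/
theorem Hom.injective_dualMap_app_of_quasiRetract (hN : N ≠ 0) (hψφ : ∀ (s : S) (u : D.VZ.fiber s), ψ.app s (φ.app s u) = N • u) (s : S) :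
    Function.Injective (ψ.dualMap.app s) := by
  rw [injective_iff_map_eq_zero]
  intro χ hχ
  change Module.Dual ℤ (D.VZ.fiber s) at χ
  have hχ' : ∀ v : D'.VZ.fiber s, χ (ψ.app s v) = 0 := fun v => by
    have h := LinearMap.congr_fun (show (χ ∘ₗ ψ.app s : Module.Dual ℤ (D'.VZ.fiber s)) = 0 from hχ) v
    simpa only [LinearMap.comp_apply, LinearMap.zero_apply] using h
  change χ = (0 : Module.Dual ℤ (D.VZ.fiber s))
  refine LinearMap.ext fun u => ?_
  have h := hχ' (φ.app s u)
  rw [hψφ, map_zsmul, zsmul_eq_mul, mul_eq_zero] at h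
  simpa only [LinearMap.zero_apply] using h.resolve_left hN

/-- **ALONG A QUASI-RETRACT `u` IS GENERIC IFF `φ u` IS** (`ψ (φ u) = N u`; elementary — no strictness). [cite: VoisinHodgeII2003, §5.3.1]
[cite: GreenGriffithsKerr2012, Ch. III (III.2)] -/
theorem isHodgeAlong_app_iff_of_quasiRetract (hN : N ≠ 0) (hψφ : ∀ (s : S) (u : D.VZ.fiber s), ψ.app s (φ.app s u) = N • u) {p : ℤ} {s : S}
    (u : D.VZ.fiber s) (W : Set S) : D'.IsHodgeAlong p (φ.app s u) W ↔ D.IsHodgeAlong p u W := by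
  refine ⟨fun hu => ?_, fun hu => φ.isHodgeAlong_app hu⟩
  have h := ψ.isHodgeAlong_app hu
  rw [hψφ] at h
  exact (D.isHodgeAlong_zsmul_iff hN u W).1 h

/-- **The exceptional Hodge locus grows along a quasi-retract**: `exceptionalHodgeLocus D p ⊆ exceptionalHodgeLocus D' p`.
[cite: VoisinHodgeII2003, §5.3.1 and §5.3.3] [cite: GreenGriffithsKerr2012, Ch. III (III.2)] -/
theorem exceptionalHodgeLocus_subset_of_quasiRetract (hN : N ≠ 0) (hψφ : ∀ (s : S) (u : D.VZ.fiber s), ψ.app s (φ.app s u) = N • u) (p : ℤ) :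
    D.exceptionalHodgeLocus p ⊆ D'.exceptionalHodgeLocus p := by
  rintro s ⟨u, hu, hnot⟩
  exact ⟨φ.app s u, φ.isHodgeAt_app hu, fun hgen => hnot ((isHodgeAlong_app_iff_of_quasiRetract hN hψφ u univ).1 hgen)⟩

/-- **ISOGENOUS VHS DATA HAVE THE SAME EXCEPTIONAL HODGE LOCI** (`ψ ∘ φ = N`, `φ ∘ ψ = N'`, `N, N' ≠ 0`). [cite: GreenGriffithsKerr2012, Ch. I (I.B) and Ch. III (III.2)] -/
theorem exceptionalHodgeLocus_eq_of_isogeny {N' : ℤ} (hN : N ≠ 0) (hN' : N' ≠ 0) (hψφ : ∀ (s : S) (u : D.VZ.fiber s), ψ.app s (φ.app s u) = N • u)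
    (hφψ : ∀ (s : S) (v : D'.VZ.fiber s), φ.app s (ψ.app s v) = N' • v) (p : ℤ) : D.exceptionalHodgeLocus p = D'.exceptionalHodgeLocus p :=
  (exceptionalHodgeLocus_subset_of_quasiRetract hN hψφ p).antisymm (exceptionalHodgeLocus_subset_of_quasiRetract hN' hφψ p)

end QuasiRetract

/-! ## §3 Tensor constructions of lattice-injective morphisms -/

section Tensor

variable {k₁ k₂ : ℤ} {D₁ D₁' : VHSData S k₁} {D₂ D₂' : VHSData S k₂}

/-- **Tensor products of lattice-injective morphisms are lattice-injective** (lattices are free, hence flat, `ℤ`-modules).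
[cite: BourbakiAlgebraI1989, Ch. II §4 and §5] -/
theorem Hom.injective_tensor_app (φ : Hom D₁ D₁') (ψ : Hom D₂ D₂') {s : S} (hφ : Function.Injective (φ.app s)) (hψ : Function.Injective (ψ.app s)) :
    Function.Injective ((φ.tensor ψ).app s) := by
  haveI : Module.Free ℤ (D₁'.VZ.fiber s) := D₁'.free s
  haveI : Module.Free ℤ (D₂.VZ.fiber s) := D₂.free s
  rw [Hom.tensor_app]
  exact TensorProduct.map_injective_of_flat_flat _ _ hφ hψ

end Tensor

section TensorPow

variable {D D' : VHSData S k}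

/-- **Tensor powers of a lattice-injective morphism are lattice-injective.** [cite: BourbakiAlgebraI1989, Ch. II §4 and §5] [cite: Deligne1982HodgeCycles, I §3, 3.1] -/
theorem Hom.injective_tensorPow_app (φ : Hom D D') {s : S} (hφ : Function.Injective (φ.app s)) (a : ℕ) :
    Function.Injective ((Hom.tensorPow φ a).app s) := by
  induction a with
  | zero => exact fun x y h => h
  | succ a ih =>
    rw [Hom.tensorPow_succ]
    exact (Hom.tensorPow φ a).injective_tensor_app φ ih hφ

variable {φ : Hom D D'} {ψ : Hom D' D} {N : ℤ}

/-- **`φ^{⊗a} ⊗ (ψ^∨)^{⊗b} : T^{a,b}D → T^{a,b}D'` IS INJECTIVE ON LATTICES** for a quasi-retract `ψ ∘ φ = N ≠ 0`.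
[cite: Deligne1982HodgeCycles, I §3, 3.1] [cite: BourbakiAlgebraI1989, Ch. II §4 and §5] -/
theorem injective_tensorSpaceMap_app_of_quasiRetract (hN : N ≠ 0) (hψφ : ∀ (s : S) (u : D.VZ.fiber s), ψ.app s (φ.app s u) = N • u) (a b : ℕ)
    (s : S) : Function.Injective (((Hom.tensorPow φ a).tensor (Hom.tensorPow ψ.dualMap b)).app s) :=
  (Hom.tensorPow φ a).injective_tensor_app _ ((φ.injective_tensorPow_app (Hom.injective_app_of_quasiRetract hN hψφ s)) a)
    ((ψ.dualMap.injective_tensorPow_app (Hom.injective_dualMap_app_of_quasiRetract hN hψφ s)) b)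

/-- **THE EXCEPTIONAL LOCI OF ALL `T^{a,b}` GROW ALONG A QUASI-RETRACT**: `exceptionalHodgeLocus (T^{a,b}D) p ⊆ exceptionalHodgeLocus (T^{a,b}D') p` (the
injective morphism `φ^{⊗a} ⊗ (ψ^∨)^{⊗b}` reflects generic classes — strictness). [cite: VoisinHodgeII2003, §5.3.3] [cite: Deligne1982HodgeCycles, I §3, 3.1]
[cite: DeligneHodgeII1971, Thm. 2.3.5] -/
theorem exceptionalHodgeLocus_tensorSpace_subset_of_quasiRetract (hN : N ≠ 0) (hψφ : ∀ (s : S) (u : D.VZ.fiber s), ψ.app s (φ.app s u) = N • u)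
    (a b : ℕ) (p : ℤ) : (D.tensorSpace a b).exceptionalHodgeLocus p ⊆ (D'.tensorSpace a b).exceptionalHodgeLocus p :=
  exceptionalHodgeLocus_subset_of_forall_injective (D := (D.tensorPow a).tensor (D.dual.tensorPow b))
    (D' := (D'.tensorPow a).tensor (D'.dual.tensorPow b)) ((Hom.tensorPow φ a).tensor (Hom.tensorPow ψ.dualMap b))
    (injective_tensorSpaceMap_app_of_quasiRetract hN hψφ a b) p

/-- **Isogenous VHS data have the same exceptional loci in every `T^{a,b}`.** [cite: GreenGriffithsKerr2012, Ch. I (I.B) and Ch. III (III.2)] -/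
theorem exceptionalHodgeLocus_tensorSpace_eq_of_isogeny {N' : ℤ} (hN : N ≠ 0) (hN' : N' ≠ 0)
    (hψφ : ∀ (s : S) (u : D.VZ.fiber s), ψ.app s (φ.app s u) = N • u) (hφψ : ∀ (s : S) (v : D'.VZ.fiber s), φ.app s (ψ.app s v) = N' • v)
    (a b : ℕ) (p : ℤ) : (D.tensorSpace a b).exceptionalHodgeLocus p = (D'.tensorSpace a b).exceptionalHodgeLocus p :=
  (exceptionalHodgeLocus_tensorSpace_subset_of_quasiRetract hN hψφ a b p).antisymm (exceptionalHodgeLocus_tensorSpace_subset_of_quasiRetract hN' hφψ a b p)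

/-! ## §4 Hodge-generic loci of isogenous VHS data -/

/-- **HODGE-GENERIC POINTS OF `D'` ARE HODGE-GENERIC FOR `D` ALONG A QUASI-RETRACT `ψ ∘ φ = N ≠ 0`.** [cite: GreenGriffithsKerr2012, Ch. III (III.2)]
[cite: VoisinHodgeII2003, §5.3.3] -/
theorem hodgeGenericLocus_subset_of_quasiRetract (hN : N ≠ 0) (hψφ : ∀ (s : S) (u : D.VZ.fiber s), ψ.app s (φ.app s u) = N • u) :
    D'.hodgeGenericLocus ⊆ D.hodgeGenericLocus :=
  fun _ hs a b p hp hmem => hs a b p hp (exceptionalHodgeLocus_tensorSpace_subset_of_quasiRetract hN hψφ a b p hmem)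

/-- **HODGE-GENERICITY IS AN ISOGENY INVARIANT**: `hodgeGenericLocus D = hodgeGenericLocus D'` for `ψ ∘ φ = N`, `φ ∘ ψ = N'`, `N, N' ≠ 0`.
[cite: GreenGriffithsKerr2012, Ch. I (I.B) and Ch. III (III.2)] [cite: VoisinHodgeII2003, §5.3.3] -/
theorem hodgeGenericLocus_eq_of_isogeny {N' : ℤ} (hN : N ≠ 0) (hN' : N' ≠ 0) (hψφ : ∀ (s : S) (u : D.VZ.fiber s), ψ.app s (φ.app s u) = N • u)
    (hφψ : ∀ (s : S) (v : D'.VZ.fiber s), φ.app s (ψ.app s v) = N' • v) : D.hodgeGenericLocus = D'.hodgeGenericLocus :=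
  (hodgeGenericLocus_subset_of_quasiRetract hN' hφψ).antisymm (hodgeGenericLocus_subset_of_quasiRetract hN hψφ)

end TensorPow

end Motives.VHSData

end Literature.AlgebraicGeometry

end
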